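import Literature.NumberTheory.Weil1964.ArchFollandDualPair
import Literature.RepresentationTheory.KonnoKonno2007.JunctionVacuumDefinite
import Literature.NumberTheory.Automorphic.UnitaryGroupArchSection
import HarnessLib

/-!
# Determinants through the sign frames, and the vacuum exponent of an adelic unitary dual pair at a DEFINITE place

Topic `NumberTheory/Weil1964`; namespace `Literature.NumberTheory.Weil1964`.  KERNEL ONLY (no record, no definition).
Continues `ArchFollandDualPair` (weil-2: the homomorphisms `toUForm ε … : U(⋆, H)(ℂ) →* U(P,Q)`,
`archUForm … v : U(J)(𝔸_F) →* U(P_v,Q_v)` and `archPairPlace v : U(J_V)(𝔸_F) × U(J_W)(𝔸_F) →* G_∞ = U(P_v,Q_v) × U(R_v,S_v)`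
placing the archimedean components of the adelic unitary dual pair, at the complex place `wOf v` over a real place `v`,
in Konno–Konno's sign frames) and `KonnoKonno2007/JunctionVacuumDefinite` (at a junction whose `V`-side is DEFINITE,
`IsEmpty P ∨ IsEmpty Q`, every archimedean Weil datum has the WHOLE `U(P,Q)` acting on the Gaussian by a power of `det`).

* §1 `det_scaleConj`, **`det_coe_toUForm`** — the sign-frame transport preserves determinants
  (`det (reindex ε ε (D k D⁻¹)) = det k`), `toUForm_bijective` (a composite of group isomorphisms);
* §2 **`det_coe_archUForm`** (`det (archUForm … v … u) = det (u_{w(v)})`, `u_{w(v)} = archAt (wOf v) (archPart u)`),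
  `coe_detVChar_archPairPlace` (`χ_V^m (archPairPlace v (u₁, u₂)) = det(u₁,w(v))^m`), and on the ONE-PLACE SECTION
  `adelicSingle (wOf v) u` (`u ∈ U(σ_{w(v)} J_V)(ℂ)` at `wOf v`, `1` at the other places and at the finite ones;
  `UnitaryGroupArchSection`): `archUForm … v (adelicSingle (wOf v) u) = toUForm … u` and its determinant is `det u`;
* §3 THE ADELIC FORM OF THE DEFINITE-PLACE DICHOTOMY: for every archimedean Weil datum `ω` over the junction
  `ι𝕎 (P v) (Q v) (R v) (S v)` at a place `v` where `V` is definite (`IsEmpty (P v) ∨ IsEmpty (Q v)`),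
  **`exists_forall_archPairPlace_adelicSingle_vacuum_eq_det_zpow_smul`**:
  `∃ m : ℤ, ∀ u ∈ U(σ_{w(v)} J_V)(ℂ), ω (archPairPlace v (adelicSingle (wOf v) u, 1)) h₀ = (det u)^m • h₀` — the shape
  consumed by `GelbartRogawski1991/CompatibleSplittingTwistVacuumShift.cmPairRepTwist_archSingle_one_eq_zpow_smul`
  once the place-`v` factor of the adelic Weil representation is identified with `ω` (the cell's junction (J-plc));
  and **`forall_archPairPlace_adelicSingle_vacuum_eq_self_iff`**: the Gaussian is fixed by every such `u` iff `m = 0`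
  (transport of `forall_fst_vacuum_eq_self_iff_of_isEmpty_right/left` along the bijection `u ↦ toUForm … u`).

Use (Hodge-CM model-construction cell, BINDER-TRIAGE §61–§62, ticket D-5 (c5)/(S-norm)): this is the determinant glue
between the sign frames of the theta-majorant pin (`archPairPlace`), the junction dichotomy (p188834) and the twist
bookkeeping (p188957).  Everything is proved; no cited statement is a hypothesis.

References: [KonnoKonno2007] §3.1 (3.1); [MoeglinVignerasWaldspurger1987] Ch. 1 I.17; [PlatonovRapinchuk1994] §2.3
(isometric forms have conjugate unitary groups); [BorelJacquet1979] §4.1 (`G_∞ = ∏_v G(F_v)`).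
-/

set_option autoImplicit false

open scoped Matrix
open NumberField NumberField.InfinitePlace NumberField.mixedEmbedding
open Literature.NumberTheory.Automorphic Literature.NumberTheory.Automorphic.UnitaryGroup
open Literature.RepresentationTheory.HeisenbergGroup Literature.Analysis.SegalBargmann
open Literature.RepresentationTheory.KonnoKonno2007 Literature.RepresentationTheory.KonnoKonno2007.RealDualPair

noncomputable section

namespace Literature.NumberTheory.Weil1964

/-! ## §1 The sign-frame transport preserves determinants -/

section Det

variable {n : Type*} [Fintype n] [DecidableEq n] {P Q : Type*} [Fintype P] [DecidableEq P] [Fintype Q]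
  [DecidableEq Q]

/-- `det (D K D⁻¹) = det K` for the adapted diagonal scaling. [folklore] -/
theorem det_scaleConj (D : n → ℝ) (hD : ∀ j, D j ≠ 0) (K : Matrix n n ℂ) : (scaleConj D K).det = K.det := by
  rw [← scaleGL_mul_mul_inv D hD K, Matrix.coe_units_inv, Matrix.det_conj (Units.isUnit _)]

/-- **`det (toUForm ε … k) = det k`**: conjugating by the Sylvester datum and sorting by the sign frame does not change
the determinant. [cite: PlatonovRapinchuk1994, §2.3] -/
theorem det_coe_toUForm (ε : n ≃ P ⊕ Q) {D : n → ℝ} (hD0 : ∀ j, D j ≠ 0) {c : ℝ} (hc : c ≠ 0)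
    {H : Matrix n n ℂ} (hH : formCongr (starRingEnd ℂ) (scaleGL D hD0) (((c : ℂ) • signForm P Q).submatrix ε ε) = H)
    (k : unitaryGroupOfForm (starRingEnd ℂ) H) :
    ((((toUForm ε hD0 hc hH k : UForm P Q) : GL (P ⊕ Q) ℂ) : Matrix (P ⊕ Q) (P ⊕ Q) ℂ)).det =
      (((k : unitaryGroupOfForm (starRingEnd ℂ) H) : GL n ℂ) : Matrix n n ℂ).det := by
  rw [coe_toUForm, Matrix.det_reindex_self, det_scaleConj D hD0]

/-- `toUForm ε …` is a bijection (a composite of group isomorphisms). [cite: PlatonovRapinchuk1994, §2.3] -/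
theorem toUForm_bijective (ε : n ≃ P ⊕ Q) {D : n → ℝ} (hD0 : ∀ j, D j ≠ 0) {c : ℝ} (hc : c ≠ 0)
    {H : Matrix n n ℂ}
    (hH : formCongr (starRingEnd ℂ) (scaleGL D hD0) (((c : ℂ) • signForm P Q).submatrix ε ε) = H) :
    Function.Bijective (toUForm ε hD0 hc hH) :=
  (MulEquiv.subgroupCongr (unitaryGroupOfForm_smul_eq (signForm P Q) hc)).bijective.comp
    ((unitaryGroupOfFormReindex (starRingEnd ℂ) ε ((c : ℂ) • signForm P Q)).toMulEquiv.bijective.comp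
      (unitaryGroupOfFormCongrOfEq (starRingEnd ℂ) (scaleGL D hD0) (((c : ℂ) • signForm P Q).submatrix ε ε) H
        hH).toMulEquiv.bijective)

end Det

/-! ## §2 The archimedean component at one place: determinants, and the one-place section -/

section Arch

variable {F : Type} [Field F] [NumberField F] (E : Type) [Field E] [NumberField E] [Algebra F E] (c : E ≃ₐ[F] E)
variable (N : ℕ) (hc : c ≠ 1)
  (wOf : {v : InfinitePlace F // v.IsReal} → {w : InfinitePlace E // w.IsComplex})
  (hw : ∀ v, c • (wOf v).1 = (wOf v).1) (hover : ∀ v, (wOf v).1.comap (algebraMap F E) = v.1)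
  (t₀ : Fin N → F) {J : Matrix (Fin N) (Fin N) E} (hJ : J = (Matrix.diagonal t₀).map (algebraMap F E))
  (v : {v : InfinitePlace F // v.IsReal}) {P Q : Type*} [Fintype P] [DecidableEq P] [Fintype Q] [DecidableEq Q]
  (ε : Fin N ≃ P ⊕ Q) {D : Fin N → ℝ} (hD0 : ∀ j, D j ≠ 0) {c' : ℝ} (hc' : c' ≠ 0)
  (ht : ∀ j, embedding_of_isReal v.2 (t₀ j) = c' * signOf (ε j) * D j ^ 2)

/-- **`det (archUForm … v … u) = det (u_{w(v)})`**, `u_{w(v)} = archAt (wOf v) (archPart u) ∈ U(σ_{w(v)} J)(ℂ)`.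
[cite: BorelJacquet1979, §4.1] -/
theorem det_coe_archUForm (u : UnitaryGroup.adelic F E c N J) :
    ((((archUForm E c N hc wOf hw hover t₀ hJ v ε hD0 hc' ht u : UForm P Q) : GL (P ⊕ Q) ℂ) :
        Matrix (P ⊕ Q) (P ⊕ Q) ℂ)).det =
      (((archAt F E c N J (wOf v) (hw v) hc (archPart F E c N J u) : archLocal E N J (wOf v)) : GL (Fin N) ℂ) :
        Matrix (Fin N) (Fin N) ℂ).det := by
  rw [coe_archUForm, Matrix.det_reindex_self, det_scaleConj D hD0]

variable (hfix : ∀ w : InfinitePlace E, c • w = w)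

/-- the `wOf v`-component of the one-place section `adelicSingle (wOf v) u` is `u`. [cite: BorelJacquet1979, §4.1] -/
theorem archAt_archPart_adelicSingle (u : archLocal E N J (wOf v)) :
    archAt F E c N J (wOf v) (hw v) hc (archPart F E c N J (adelicSingle F E c N J hc hfix (wOf v) u)) = u := by
  rw [archPart_adelicSingle]
  exact archAt_archSingle_self F E c N J hc hfix (wOf v) u

/-- **On the one-place section**: `archUForm … v (adelicSingle (wOf v) u) = toUForm … u` — the adelic element with
`u` at `wOf v` and `1` elsewhere is placed in the sign frame as `u` itself. [cite: BorelJacquet1979, §4.1] -/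
theorem archUForm_adelicSingle (u : archLocal E N J (wOf v)) :
    archUForm E c N hc wOf hw hover t₀ hJ v ε hD0 hc' ht (adelicSingle F E c N J hc hfix (wOf v) u) =
      toUForm ε hD0 hc' ((formCongr_scaleGL_smul_signForm ε hD0 c' ht).trans
        (archLocalForm_diagonal E c N hc wOf hw hover t₀ hJ v).symm) u :=
  congrArg (toUForm ε hD0 hc' ((formCongr_scaleGL_smul_signForm ε hD0 c' ht).trans
      (archLocalForm_diagonal E c N hc wOf hw hover t₀ hJ v).symm))
    (archAt_archPart_adelicSingle E c N hc wOf hw v hfix u)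

/-- … so its determinant is `det u`. [cite: BorelJacquet1979, §4.1] -/
theorem det_coe_archUForm_adelicSingle (u : archLocal E N J (wOf v)) :
    ((((archUForm E c N hc wOf hw hover t₀ hJ v ε hD0 hc' ht (adelicSingle F E c N J hc hfix (wOf v) u) : UForm P Q) :
        GL (P ⊕ Q) ℂ) : Matrix (P ⊕ Q) (P ⊕ Q) ℂ)).det =
      (((u : archLocal E N J (wOf v)) : GL (Fin N) ℂ) : Matrix (Fin N) (Fin N) ℂ).det := by
  rw [det_coe_archUForm, archAt_archPart_adelicSingle E c N hc wOf hw v hfix u]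

/-- `u ↦ archUForm … v (adelicSingle (wOf v) u)` is onto `U(P,Q)` (it is the bijection `toUForm`). [folklore] -/
theorem archUForm_adelicSingle_surjective :
    Function.Surjective fun u : archLocal E N J (wOf v) =>
      archUForm E c N hc wOf hw hover t₀ hJ v ε hD0 hc' ht (adelicSingle F E c N J hc hfix (wOf v) u) := by
  intro g
  obtain ⟨u, hu⟩ := (toUForm_bijective ε hD0 hc' ((formCongr_scaleGL_smul_signForm ε hD0 c' ht).trans
    (archLocalForm_diagonal E c N hc wOf hw hover t₀ hJ v).symm)).2 g
  exact ⟨u, (archUForm_adelicSingle E c N hc wOf hw hover t₀ hJ v ε hD0 hc' ht hfix u).trans hu⟩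

end Arch

/-! ## §3 The pair at a definite place: the vacuum exponent in the adelic currency -/

section Pair

variable {F : Type} [Field F] [NumberField F] (E : Type) [Field E] [NumberField E] [Algebra F E] (c : E ≃ₐ[F] E)
variable (N M : ℕ) (hc : c ≠ 1)
  (wOf : {v : InfinitePlace F // v.IsReal} → {w : InfinitePlace E // w.IsComplex})
  (hw : ∀ v, c • (wOf v).1 = (wOf v).1) (hover : ∀ v, (wOf v).1.comap (algebraMap F E) = v.1)
  (tV : Fin N → F) (tW : Fin M → F) {JV : Matrix (Fin N) (Fin N) E} {JW : Matrix (Fin M) (Fin M) E}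
  (hJV : JV = (Matrix.diagonal tV).map (algebraMap F E)) (hJW : JW = (Matrix.diagonal tW).map (algebraMap F E))
  {P Q R S : {v : InfinitePlace F // v.IsReal} → Type*} [∀ v, Fintype (P v)] [∀ v, DecidableEq (P v)]
  [∀ v, Fintype (Q v)] [∀ v, DecidableEq (Q v)] [∀ v, Fintype (R v)] [∀ v, DecidableEq (R v)]
  [∀ v, Fintype (S v)] [∀ v, DecidableEq (S v)]
  (εV : ∀ v, Fin N ≃ P v ⊕ Q v) (εW : ∀ v, Fin M ≃ R v ⊕ S v)
  {DV : {v : InfinitePlace F // v.IsReal} → Fin N → ℝ} {DW : {v : InfinitePlace F // v.IsReal} → Fin M → ℝ}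
  (hDV0 : ∀ v i, DV v i ≠ 0) (hDW0 : ∀ v j, DW v j ≠ 0) {cV cW : {v : InfinitePlace F // v.IsReal} → ℝ}
  (hcV : ∀ v, cV v ≠ 0) (hcW : ∀ v, cW v ≠ 0)
  (htV : ∀ v i, embedding_of_isReal v.2 (tV i) = cV v * signOf (εV v i) * DV v i ^ 2)
  (htW : ∀ v j, embedding_of_isReal v.2 (tW j) = cW v * signOf (εW v j) * DW v j ^ 2)
  (v : {v : InfinitePlace F // v.IsReal})

/-- the `U(V)`-component of `archPairPlace v (u₁, u₂)` is `archUForm … v … u₁`. [folklore] -/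
theorem archPairPlace_fst (u : UnitaryGroup.adelic F E c N JV × UnitaryGroup.adelic F E c M JW) :
    (archPairPlace E c N M hc wOf hw hover tV tW hJV hJW εV εW hDV0 hDW0 hcV hcW htV htW v u).1 =
      archUForm E c N hc wOf hw hover tV hJV v (εV v) (hDV0 v) (hcV v) (htV v) u.1 := rfl

/-- the `U(W)`-component of `archPairPlace v (u₁, u₂)` is `archUForm … v … u₂`. [folklore] -/
theorem archPairPlace_snd (u : UnitaryGroup.adelic F E c N JV × UnitaryGroup.adelic F E c M JW) :
    (archPairPlace E c N M hc wOf hw hover tV tW hJV hJW εV εW hDV0 hDW0 hcV hcW htV htW v u).2 =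
      archUForm E c M hc wOf hw hover tW hJW v (εW v) (hDW0 v) (hcW v) (htW v) u.2 := rfl

/-- **`χ_V^m (archPairPlace v (u₁, u₂)) = det(u₁,w(v))^m`** (`detVChar` of `KonnoKonno2007/JunctionDetCharacters`).
[cite: KonnoKonno2007, §3.1 (3.1)] -/
theorem coe_detVChar_archPairPlace (m : ℤ) (u : UnitaryGroup.adelic F E c N JV × UnitaryGroup.adelic F E c M JW) :
    ((detVChar (P v) (Q v) (R v) (S v) m
        (archPairPlace E c N M hc wOf hw hover tV tW hJV hJW εV εW hDV0 hDW0 hcV hcW htV htW v u) : Circle) : ℂ) =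
      (((archAt F E c N JV (wOf v) (hw v) hc (archPart F E c N JV u.1) : archLocal E N JV (wOf v)) : GL (Fin N) ℂ) :
        Matrix (Fin N) (Fin N) ℂ).det ^ m := by
  rw [coe_detVChar, archPairPlace_fst, det_coe_archUForm]

variable (hfix : ∀ w : InfinitePlace E, c • w = w)

/-- `archPairPlace v (adelicSingle (wOf v) u, 1) = (toUForm … u, 1)`. [folklore] -/
theorem archPairPlace_adelicSingle_one (u : archLocal E N JV (wOf v)) :
    archPairPlace E c N M hc wOf hw hover tV tW hJV hJW εV εW hDV0 hDW0 hcV hcW htV htW v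
        (adelicSingle F E c N JV hc hfix (wOf v) u, 1) =
      (archUForm E c N hc wOf hw hover tV hJV v (εV v) (hDV0 v) (hcV v) (htV v)
        (adelicSingle F E c N JV hc hfix (wOf v) u), 1) :=
  Prod.ext (archPairPlace_fst E c N M hc wOf hw hover tV tW hJV hJW εV εW hDV0 hDW0 hcV hcW htV htW v _)
    ((archPairPlace_snd E c N M hc wOf hw hover tV tW hJV hJW εV εW hDV0 hDW0 hcV hcW htV htW v _).trans
      (map_one _))

variable {ω : Representation ℂ (Ginf (P v) (Q v) (R v) (S v)) (SchwartzMap (DPIdx (P v) (Q v) (R v) (S v) → ℝ) ℂ)}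

/-- **THE VACUUM EXPONENT AT A DEFINITE PLACE, ADELIC CURRENCY.**  If `V` is definite at `v` (`P v` or `Q v` empty),
every archimedean Weil datum `ω` over the place-`v` junction has an integer `m` with
`ω (archPairPlace v (adelicSingle (wOf v) u, 1)) h₀ = (det u)^m • h₀` for every `u ∈ U(σ_{w(v)} J_V)(ℂ)`.
[cite: KonnoKonno2007, §3.1 (3.1); Folland1989, Prop (4.39)] -/
theorem exists_forall_archPairPlace_adelicSingle_vacuum_eq_det_zpow_smul (hVdef : IsEmpty (P v) ∨ IsEmpty (Q v))
    (hω : IsArchWeilDatum (ι𝕎 (P v) (Q v) (R v) (S v)) ω) :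
    ∃ m : ℤ, ∀ u : archLocal E N JV (wOf v),
      ω (archPairPlace E c N M hc wOf hw hover tV tW hJV hJW εV εW hDV0 hDW0 hcV hcW htV htW v
          (adelicSingle F E c N JV hc hfix (wOf v) u, 1)) (hermitePi 0) =
        ((((u : archLocal E N JV (wOf v)) : GL (Fin N) ℂ) : Matrix (Fin N) (Fin N) ℂ).det ^ m) • hermitePi 0 := by
  obtain ⟨m, hm⟩ := exists_forall_fst_vacuum_eq_det_zpow_smul (R := R v) (S := S v) hVdef hω
  refine ⟨m, fun u => ?_⟩
  rw [archPairPlace_adelicSingle_one, hm, det_coe_archUForm_adelicSingle]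

/-- **… and the Gaussian is FIXED by every `u ∈ U(σ_{w(v)} J_V)(ℂ)` iff `m = 0`** (`V` positive definite in the
frame: `Q v` empty, `P v` nonempty). [cite: BrockerTomDieck1985, Ch. II Prop. 8.1] -/
theorem forall_archPairPlace_adelicSingle_vacuum_eq_self_iff_of_isEmpty_right [IsEmpty (Q v)] [Nonempty (P v)]
    {m : ℤ}
    (hm : ∀ u : archLocal E N JV (wOf v),
      ω (archPairPlace E c N M hc wOf hw hover tV tW hJV hJW εV εW hDV0 hDW0 hcV hcW htV htW v
          (adelicSingle F E c N JV hc hfix (wOf v) u, 1)) (hermitePi 0) =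
        ((((u : archLocal E N JV (wOf v)) : GL (Fin N) ℂ) : Matrix (Fin N) (Fin N) ℂ).det ^ m) • hermitePi 0) :
    (∀ u : archLocal E N JV (wOf v),
      ω (archPairPlace E c N M hc wOf hw hover tV tW hJV hJW εV εW hDV0 hDW0 hcV hcW htV htW v
          (adelicSingle F E c N JV hc hfix (wOf v) u, 1)) (hermitePi 0) = hermitePi 0) ↔ m = 0 := by
  -- transport along the surjection `u ↦ archUForm … (adelicSingle … u)` onto `U(P,Q)`
  have hsurj := archUForm_adelicSingle_surjective E c N hc wOf hw hover tV hJV v (εV v) (hDV0 v) (hcV v) (htV v) hfix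
  have hm' : ∀ g : UForm (P v) (Q v),
      ω (g, 1) (hermitePi 0) = ((((g : GL (P v ⊕ Q v) ℂ) : Matrix (P v ⊕ Q v) (P v ⊕ Q v) ℂ)).det ^ m) • hermitePi 0 := by
    intro g
    obtain ⟨u, rfl⟩ := hsurj g
    beta_reduce
    have h := hm u
    rw [archPairPlace_adelicSingle_one] at h
    rw [h, det_coe_archUForm_adelicSingle]
  constructor
  · intro h
    refine (forall_fst_vacuum_eq_self_iff_of_isEmpty_right (R := R v) (S := S v) hm').1 fun g => ?_
    obtain ⟨u, rfl⟩ := hsurj g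
    beta_reduce
    have h1 := h u
    rwa [archPairPlace_adelicSingle_one] at h1
  · intro h0 u
    rw [hm u, h0, zpow_zero, one_smul]

/-- The same for `V` negative definite in the frame (`P v` empty, `Q v` nonempty). [cite: BrockerTomDieck1985, Ch. II Prop. 8.1] -/
theorem forall_archPairPlace_adelicSingle_vacuum_eq_self_iff_of_isEmpty_left [IsEmpty (P v)] [Nonempty (Q v)]
    {m : ℤ}
    (hm : ∀ u : archLocal E N JV (wOf v),
      ω (archPairPlace E c N M hc wOf hw hover tV tW hJV hJW εV εW hDV0 hDW0 hcV hcW htV htW v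
          (adelicSingle F E c N JV hc hfix (wOf v) u, 1)) (hermitePi 0) =
        ((((u : archLocal E N JV (wOf v)) : GL (Fin N) ℂ) : Matrix (Fin N) (Fin N) ℂ).det ^ m) • hermitePi 0) :
    (∀ u : archLocal E N JV (wOf v),
      ω (archPairPlace E c N M hc wOf hw hover tV tW hJV hJW εV εW hDV0 hDW0 hcV hcW htV htW v
          (adelicSingle F E c N JV hc hfix (wOf v) u, 1)) (hermitePi 0) = hermitePi 0) ↔ m = 0 := by
  have hsurj := archUForm_adelicSingle_surjective E c N hc wOf hw hover tV hJV v (εV v) (hDV0 v) (hcV v) (htV v) hfix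
  have hm' : ∀ g : UForm (P v) (Q v),
      ω (g, 1) (hermitePi 0) = ((((g : GL (P v ⊕ Q v) ℂ) : Matrix (P v ⊕ Q v) (P v ⊕ Q v) ℂ)).det ^ m) • hermitePi 0 := by
    intro g
    obtain ⟨u, rfl⟩ := hsurj g
    beta_reduce
    have h := hm u
    rw [archPairPlace_adelicSingle_one] at h
    rw [h, det_coe_archUForm_adelicSingle]
  constructor
  · intro h
    refine (forall_fst_vacuum_eq_self_iff_of_isEmpty_left (R := R v) (S := S v) hm').1 fun g => ?_
    obtain ⟨u, rfl⟩ := hsurj g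
    beta_reduce
    have h1 := h u
    rwa [archPairPlace_adelicSingle_one] at h1
  · intro h0 u
    rw [hm u, h0, zpow_zero, one_smul]

end Pair

end Literature.NumberTheory.Weil1964
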